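import Summits.BirchSwinnertonDyer.Rank1Residual.X11b.Three.KolyvaginShaFiniteThreeRat
import Summits.BirchSwinnertonDyer.Rank1Residual.X11b.MultiplicativeSurjectivity
import HarnessLib

/-!
# X11b @ 3 ∩ (KN₃): `ρ̄_{E,3}` onto is AUTOMATIC, so `Ш(E/K)[3^∞]` is finite from FIVE cite-only
# inputs AT `3` with NO image hypothesis

Cell `b2b-bsdres`, team x11b3 (N8/O2); seat x11b3-p2 GEN 35 ((P2-PERPRIME), optional FILE 6;
depends on FILE 5 `X11b/Three/KolyvaginShaFiniteThreeRat`).  Summit-side THEOREM-ONLY file (no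
definition, no named fact, no `sorry`); `K : Type`; the literal prime `3`.

HONEST FRAMING (binding): **plumbing — two tree theorems composed, nothing discharged.**  FILE 5's
END `Three.sha_primary_finite_three_of_classX11b_of_kodairaNeron_rat` carries the binder
`(_hρ : W.HasSurjectiveModNGaloisRep 3)`.  On its own class it is REDUNDANT: (KN₃) read off the
ℚ-side data contains `3 ∤ ord_3(Δ_min(E/ℚ))` at the multiplicative prime `3` itself (`3 ‖ N`), and
the tree theorem `ClassX11b.surj_of_not_dvd` (`X11b/MultiplicativeSurjectivity`, from
`surj_of_mult_of_irr_of_not_dvd`: a Tate-curve transvection at `3` of order `3` in an irreducible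
image forces `GL₂(𝔽₃)`, Serre 1972 Prop. 15 / Silverman *ATAEC* V.6) gives `ρ̄_{E,3}` onto from
`ClassX11b W 3` (`mult(3) ∧ irr(3)`) and `3 ∤ v_3(Δ_min)`; the place / prime bridges are the tree's
`WeierstrassCurve.hasMultiplicativeReductionAtPrime_iff_hasMultiplicativeReductionAt_ringOfIntegers`
and `X11b.ordMinimalDiscriminant_eq_padicValInt`.  So on `ClassX11b W 3` ∩ (KN₃)/ℚ the
`3`-primary finiteness holds from EXACTLY {`hPT`, `hrec`, `hCM₃`, `h53₃`, `hγ₃`} + `hN` with NO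
image binder; the CORNER (`¬Surj`, 3Ns / 3Nn images) is disjoint from (KN₃) by the same theorem
(census check of record: `¬surj ⇒ 3 ∣ v_3(Δ_min)`, multr1-p2 census3, 0 violations).  Cite-only
labelled hypotheses, NOT facts, NOT discharged; nothing booked; no mark / label / count / tier
moves; node `Three.HsiehDescentAt₃` and its FOUR antecedents untouched; #(KN₃) not asserted.

What is proved (namespace `…X11b.Three`): `surj_three_of_classX11b_of_kodairaNeron_rat`
(`ClassX11b W 3` + (KN₃)-multiplicative clause over `ℚ` ⟹ `Surj W 3`) and the END
`sha_primary_finite_three_of_classX11b_of_kodairaNeron_rat'` (FILE 5's class END without `_hρ`).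
References: [Serre1972] §2.4 Prop. 15; [SilvermanATAEC1994] V.6 Prop. 6.1; [McCallumLMS1991] §1
Theorem (per prime); [GrossLMS1991] Thm. 1.3 (2).  presearch: `lean search 'surj_of_not_dvd'` →
`ClassX11b.surj_of_not_dvd` (tree); nothing minted.
-/

noncomputable section

open scoped Classical
open WeierstrassCurve Field NumberField IsDedekindDomain
open Literature.NumberTheory.EllipticCurves Literature.NumberTheory.GaloisRepresentations
open Literature.NumberTheory.EllipticCurves.Rank1Residual
open Literature.NumberTheory.EllipticCurves.RingClassField
open Literature.NumberTheory.EllipticCurves.ModularForms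
open Literature.NumberTheory.DiophantineGeometry Literature.NumberTheory.DiophantineGeometry.TateAlgorithm
open Summit.BirchSwinnertonDyer.Rank1Residual.X11b.KolyvaginAssembly

namespace Summit.BirchSwinnertonDyer.Rank1Residual.X11b.Three

-- `K : Type`: the tree's ring-class class field theory is universe `0`.
variable {K : Type} [Field K] [NumberField K] {N : ℕ} {W : WeierstrassCurve ℚ}

/-- **On `ClassX11b W 3`, the multiplicative clause of (KN₃)/ℚ forces `ρ̄_{E,3}` onto.**  If `E`
has multiplicative reduction at `3` with `E[3]` irreducible (`ClassX11b W 3`) and `3 ∤ ord_v(Δ_min(E/ℚ))`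
at every multiplicative place `v` of `ℚ` — in particular at the place over `3` — then `ρ̄_{E,3}`
is surjective: `ClassX11b.surj_of_not_dvd` (Tate-curve transvection of order `3`, Serre 1972
Prop. 15) after the bridges `hasMultiplicativeReductionAtPrime_iff_hasMultiplicativeReductionAt_ringOfIntegers`
(prime `3` ↔ place over `3`) and `X11b.ordMinimalDiscriminant_eq_padicValInt`
(`ord_v Δ_min = v_3(Δ_min)` for the globally minimal `W`). [cite: Serre1972, §2.4 Prop. 15]
[cite: SilvermanATAEC1994, V.6 Prop. 6.1 (p. 410)] -/
theorem surj_three_of_classX11b_of_kodairaNeron_rat [W.IsElliptic] [W.IsGloballyMinimal]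
    (hX : ClassX11b W 3)
    (hKN3m : ∀ v : HeightOneSpectrum (𝓞 ℚ), W.HasMultiplicativeReductionAt v →
      ¬ 3 ∣ W.ordMinimalDiscriminant v) :
    W.HasSurjectiveModNGaloisRep 3 := by
  set v : HeightOneSpectrum (𝓞 ℚ) :=
    (Rat.HeightOneSpectrum.primesEquiv (R := 𝓞 ℚ)).symm ⟨3, Nat.prime_three⟩ with hvdef
  have hv : Rat.HeightOneSpectrum.primesEquiv v = ⟨3, Nat.prime_three⟩ :=
    Equiv.apply_symm_apply _ _
  have hv3 : (Rat.HeightOneSpectrum.primesEquiv v : ℕ) = 3 := congrArg Subtype.val hv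
  have hmult_v : haveI := Fact.mk (Rat.HeightOneSpectrum.primesEquiv v).2;
      W.HasMultiplicativeReductionAtPrime (Rat.HeightOneSpectrum.primesEquiv v) := by
    have key : ∀ (q : ℕ) (hq : Fact q.Prime), q = 3 →
        @WeierstrassCurve.HasMultiplicativeReductionAtPrime W q hq := by
      rintro q hq rfl; exact hX.2.2.1
    exact key _ _ hv3
  have hmultAt : W.HasMultiplicativeReductionAt v :=
    (WeierstrassCurve.hasMultiplicativeReductionAtPrime_iff_hasMultiplicativeReductionAt_ringOfIntegers
      W v).mp hmult_v
  have h3 := hKN3m v hmultAt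
  rw [X11b.ordMinimalDiscriminant_eq_padicValInt W v hv3] at h3
  exact ClassX11b.surj_of_not_dvd W 3 hX h3

/-- **On the class X11b @ 3 ∩ (KN₃)/ℚ, `Ш(E/K)[3^∞]` is finite from FIVE cite-only inputs AT `3`
— with NO image hypothesis.**  FILE 5's `sha_primary_finite_three_of_classX11b_of_kodairaNeron_rat`
with its conclusion's binder `(_hρ : ρ̄_{E,3} onto)` SUPPLIED by
`surj_three_of_classX11b_of_kodairaNeron_rat` (the (KN₃) clause at the multiplicative prime `3`
itself).  For `(E, 3) ∈ ClassX11b W 3` at `N = N_E`, every number field `K : Type`: for `K`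
imaginary quadratic with the Heegner hypothesis and `P` a non-torsion Heegner point,
`Ш(E/K)[3^∞]` is finite, CONDITIONAL on EXACTLY {`hPT`, `hrec`, `hCM`, `h53`, `hγ`} at `3` + `hN`
+ (KN₃)/ℚ (`hKN3m`, `hKN3a`); cite-only, NOT discharged; nothing booked; no mark / count / tier
moves. [cite: McCallumLMS1991, §1 Theorem (Kolyvagin)] [cite: GrossLMS1991, Thm. 1.3 (2)]
[cite: Serre1972, §2.4 Prop. 15] -/
theorem sha_primary_finite_three_of_classX11b_of_kodairaNeron_rat' [NeZero N]
    [W.IsGloballyMinimal] (hW : ClassX11b W 3)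
    (hPT : Literature.NumberTheory.GaloisCohomology.poitouTate_sum_localTatePairing_eq_zero K)
    (hN : ∀ [W.IsElliptic], N = W.conductorNorm ℤ)
    (hrec : heegnerPointOfConductor_one_galoisConj N W K)
    (hCM : ∀ [W.IsElliptic] (_hK : IsImaginaryQuadratic K) (_hH : SatisfiesHeegnerHypothesis N K)
      (Dt : ModularParametrizationData W N) (β : ℤ) (ι : K →+* ℂ),
      (4 * N : ℤ) ∣ β ^ 2 - NumberField.discr K →
      ∀ {M : ℕ}, 1 ≤ M → ∀ (m : ℕ), Squarefree m →
      (∀ q ∈ m.primeFactors, IsKolyvaginPrime N W K 3 q ∧ FrobEqFrobInfty W K (3 ^ M) q) →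
      ∃ y : (W.baseChange (ringClassField K ι m)).toAffine.Point,
        WeierstrassCurve.Affine.Point.map (W' := W) (ringClassField K ι m).subtype.toRatAlgHom y =
          heegnerPointComplexOfConductor Dt (NumberField.discr K) β m)
    (h53 : ∀ [W.IsElliptic] (_hK : IsImaginaryQuadratic K) (_hH : SatisfiesHeegnerHypothesis N K)
      (Dt : ModularParametrizationData W N) (β : ℤ) (ι : K →+* ℂ) {M : ℕ}
      (_hM : 1 ≤ M) {n : ℕ} (_hn : Squarefree n)
      (_hKol : ∀ q ∈ n.primeFactors, IsKolyvaginPrime N W K 3 q ∧ FrobEqFrobInfty W K (3 ^ M) q)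
      (d : (m : ℕ) → m ∣ n → KolyvaginHeegnerData Dt β ι m) (m : ℕ) (hm : m ∣ n)
      (τm : ringClassField K ι m ≃ₐ[ℚ] ringClassField K ι m),
      (∀ x : ringClassField K ι m, ((τm x : ringClassField K ι m) : ℂ) = starRingEnd ℂ x) →
      ∃ σ' ∈ ringClassGal ι m, IsOfFinAddOrder
        (pointGalHom W (ringClassField K ι m) τm (d m hm).y -
          (-W.rootNumber) • pointGalHom W (ringClassField K ι m) σ' (d m hm).y))
    (hKN3m : ∀ [W.IsElliptic] (v : HeightOneSpectrum (𝓞 ℚ)),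
      W.HasMultiplicativeReductionAt v → ¬ 3 ∣ W.ordMinimalDiscriminant v)
    (hKN3a : ∀ [W.IsElliptic] (v : HeightOneSpectrum (𝓞 ℚ)), W.HasAdditiveReductionAt v →
      W.kodairaSymbolAt v ≠ KodairaSymbol.IV ∧ W.kodairaSymbolAt v ≠ KodairaSymbol.IVstar)
    (hγ : ∀ [W.IsElliptic] (_hK : IsImaginaryQuadratic K) (_hH : SatisfiesHeegnerHypothesis N K)
      (Dt : ModularParametrizationData W N) (β : ℤ) (ι : K →+* ℂ) {M : ℕ}
      (_hM : 1 ≤ M) {n : ℕ} (_hn : Squarefree n)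
      (_hKol : ∀ q ∈ n.primeFactors, IsKolyvaginPrime N W K 3 q ∧ FrobEqFrobInfty W K (3 ^ M) q)
      (d : (m : ℕ) → m ∣ n → KolyvaginHeegnerData Dt β ι m)
      (m : ℕ) (hm : m ∣ n) (ℓ : ℕ) (hℓ : ℓ ∈ m.primeFactors) [Fact ℓ.Prime]
      (hΔ : ¬ (ℓ : ℤ) ∣ minimalDiscriminantInt W) (φ₀ : absoluteGaloisGroup (ZMod ℓ)),
      (∀ x : AlgebraicClosure (ZMod ℓ), φ₀ • x = x ^ ℓ) →
      ∀ (hle : ringClassField K ι (m / ℓ) ≤ ringClassField K ι m)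
        (γ : ringClassField K ι m ≃ₐ[ℚ] ringClassField K ι m), γ ∈ ringClassGal ι m →
        geomReduction hΔ ((RatClosure.pointsEquiv (K := K) W).symm
            ((d m hm).toGeomPoints (pointGalHom W (ringClassField K ι m) γ (d m hm).y))) =
          φ₀ • geomReduction hΔ ((RatClosure.pointsEquiv (K := K) W).symm
            ((d m hm).toGeomPoints (pointGalHom W (ringClassField K ι m) γ
              (WeierstrassCurve.Affine.Point.map (W' := W)
                ((RingClassField.inclusion ι hle).restrictScalars ℚ)
                (d (m / ℓ)
                  ((Nat.div_dvd_of_dvd (Nat.dvd_of_mem_primeFactors hℓ)).trans hm)).y))))) :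
    ∀ [W.IsElliptic] (_hK : IsImaginaryQuadratic K) (_hH : SatisfiesHeegnerHypothesis N K)
      {P : (W.baseChange K).toAffine.Point} (_hP : IsHeegnerPoint N W K P)
      (_hnt : ¬ IsOfFinAddOrder P),
      Set.Finite {c : (W.baseChange K).sha | ∃ j : ℕ, 3 ^ j • c = 0} := by
  intro _ hK hH P hP hnt
  exact sha_primary_finite_three_of_classX11b_of_kodairaNeron_rat hW hPT hN hrec hCM h53 hKN3m hKN3a
    hγ hK hH hP hnt (surj_three_of_classX11b_of_kodairaNeron_rat hW hKN3m)

end Summit.BirchSwinnertonDyer.Rank1Residual.X11b.Three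

end
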